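import Summits.QuantumFields.BalabanUV.Beta.WilsonBiStencilGaugeLegZ
import Summits.QuantumFields.BalabanUV.Beta.CombWilsonT2Periodised
import Summits.QuantumFields.BalabanUV.Beta.FP.PeriodisedFormGaugeLeg

/-!
# `BalabanUV.Beta.FP.PeriodisedFormGaugeLegTwo` — road «FP» (binder row D1), ROUTE T, the (J-a) dictionary's row `a2` at level 0, WILSON SECTOR, part 1:
# **THE FLUCTUATION-LEG PURE-GAUGE LAW OF THE PERIODISED WILSON BI-FAMILY** — the `dφ`-form of `WilsonBiStencilGaugeLegZ.gaugeLeg_wilsonT2_inl_inl` on `ℤ^{d+1}`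
# and its torus periodisation (file (R4a); the assembly `torus_a2_wilson` is part 2)

HONEST DEPENDENCY (page 1, mandatory): continuum YM on T⁴ ⇐ BetaPertH ∧ nine spine estimates (0/9 proved); BetaPertH ⇐ (D1) ∧ (D4) ∧ CAP+tail;
G-an2-4 gates asym, D1 and NE2/3/4.  HONEST FRAMING (cell contract, verbatim): «discharging `BetaPertH` makes Bałaban's UV stability UNCONDITIONAL —
a real constructive-QFT result; it is NOT the continuum limit and NOT the Clay problem.»  ABSOLUTE RULE (cell charter, verbatim): «No internally-minted
statement may enter as a cited fact. Every hypothesis is either kernel-proved in this package or a verbatim quotation of a PUBLISHED theorem with page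
reference. The manuscript(s) under audit are NOT citable for their own disputed steps — they are the thing under adjudication; programme-internal
(2001/route/tribunal) claims are never citable.»

WHAT ([folklore] finite sums and period unfolding BY NAME; no `def`, no `def … : Prop`, nothing cited, 0 sorry).  `T₂ := wilsonW₂ d ((8N²)⁻¹ • wsym22 N)`
(`2 ≤ N`), `V κ u := Σ'_n T₂ κ u κ′ (u′ + M∘n)` the second-slot-periodised bi-family of U21's `hW` (an2's `CombWilsonT2Periodised` letters).
* §1 **`tsum_wilsonT2_mul_dz`** — the `dφ`-FORM ON `ℤ^{d+1}` (summation by parts on the finitely supported table, then (R3)'s divergence form), for EVERY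
  `φ : ℤ^{d+1} → ℝ`: `Σ'_z Σ_β T₂ κ u κ′ u′ x z (inl α) (inl β) · dz φ β z = −½·(φ(u′+e_κ′)·wilsonA d κ u x u′ (inl α) (inl κ′) + φ(u+e_κ)·wilsonA d κ′ u′ x u (inl α) (inl κ))`
  `− ¼·[u = u′ ∧ κ = κ′]·φ(u+e_κ)·(d*d δ_{(κ,u)})_α(x) + ⅛·φ(x+e_α)·([x = u′ ∧ α = κ′]·(d*d δ_{(κ,u)})_α(x) + [x = u ∧ α = κ]·(d*d δ_{(κ′,u′)})_α(x))`
  (the order-2 twin of gan24-leaf-02's `ContactOneGaugeCellAlgebra.tsum_wilsonA_mul_dz`).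
* §2 **`sum_perZ_dper_wilsonT2per_mul_grad_periodic`** — the TORUS form against the gradient of ANY `Mℤ^{d+1}`-periodic potential, both index bonds
  and the first leg at torus points: the copies of both index bonds summed (`dper`, an2's `dper_apply_of_periodCov` ∕ `wilsonT2per_periodCov`, leaf-02's
  `dper_apply_of_blockCov`), the second leg periodised (`perZ`, O-2's `sum_perZ_mul_grad_periodic_ff`), the first-order members re-summed into leaf-05's
  `perZ M (dper M (wilsonA d κ u))`, the contact `d*d` terms into the periodised form block `perZ M (bhKStepAt d ρ L 0)` (this lineage's O-2 pattern), the
  diagonal contact surviving only between EQUAL torus bonds (`translate_eq_translate_iff`).  The torus-call corollaries and the door row `a2` are part 2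
  (`PeriodisedWardOrderTwoWilson`).
Discharges NO binder of row D1 and NO row of the door by itself; 0 estimates; 0∕4 row-D1 binders (hW, hR, D1Tel, D1Rep); NOT (J-a) complete, NOT (T-ID),
NOT SDF, NOT D1, NEVER «G-an2-4 closed», NOT BetaPertH, NOT continuum, NOT Clay.  «not in print; our bookkeeping».
Unit `b2b-balaban-beta-d1-formalise-leaf-05` (gen 35), 2026-08-23; no existing file touched.
-/

noncomputable section

namespace Summit.QuantumFields.BalabanUV.Beta.FP.PeriodisedFormGaugeLegTwo

open scoped BigOperators
open Finset
open Literature.MathematicalPhysics.QuantumFieldTheory.Balaban1983to89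
open Literature.MathematicalPhysics.QuantumFieldTheory.Balaban1983to89.Beta
open B12Sec2to5 (l1 l1_nonneg)
open B4TorusKernel.MultiPeriod (translate translate_apply)
open B6Lemma24Torus (pbox mem_pbox)
open ExpKernelCalculus (MKer shiftK l1_sub_symm l1_sub_triangle)
open AffineAveraging (Site box toSite dz curv curvAdj)
open KKTFluctuationKernel (delta1)
open OneStepResolventKernel (Fib)
open StepJetData (wilsonA wilsonA_translate)
open WilsonBiStencil (wilsonW₂ wEntry₂ wilsonW₂_inl_inl wEntry₂_eq_zero_or)
open WilsonVertex2Sym (wsym22)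
open AveragingWardStencils (b6UnitVec_eq)
open Summit.QuantumFields.BalabanUV.Beta.AxialDressingRooted (cube mem_cube)
open Summit.QuantumFields.BalabanUV.Beta.GAN24.ContactOneGaugeCellAlgebra (sum_mul_ite_eq_of_mem affine_unitVec_eq dz_apply')
open Summit.QuantumFields.BalabanUV.Beta.GAN24.Push3GaugeSlotCells (mem_cube_of_l1_le)
open Summit.QuantumFields.BalabanUV.Beta.WilsonBiStencilGaugeLegZ (gaugeLeg_wilsonT2_inl_inl)

variable {d : ℕ} {N : ℕ}

/-! ## §1 The `dφ`-form of the fluctuation-leg law on `ℤ^{d+1}` -/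

section ByParts

/-- [folklore] the bi-stencil is finitely supported in its second leg (`|z − u′|₁ ≤ 2`, an3's `wEntry₂_eq_zero_or`): any function of that leg weighted by
the table is summable. -/
theorem summable_mul_wilsonW₂ (T : Fin 4 → Fin 4 → Fin 4 → Fin 4 → ℝ) (κ : Fin (d + 1)) (u : Site (d + 1)) (κ' : Fin (d + 1)) (u' x : Site (d + 1))
    (α β : Fin (d + 1)) (g : Site (d + 1) → ℝ) :
    Summable fun z => g z * wilsonW₂ d T κ u κ' u' x z (Sum.inl α) (Sum.inl β) := by
  classical
  refine summable_of_ne_finset_zero (s := (cube (d + 1) 2).image fun v => u' + v) fun z hz => ?_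
  rw [wilsonW₂_inl_inl]
  rcases wEntry₂_eq_zero_or T κ u κ' u' x z α β with h0 | ⟨-, hzu, -⟩
  · rw [h0, mul_zero]
  · exact absurd (Finset.mem_image.2 ⟨z - u', mem_cube_of_l1_le hzu, by abel⟩) hz

open B6BondElimination (unitVec) in
/-- **[folklore] `tsum_wilsonT2_mul_dz` — THE `dφ`-FORM OF THE FLUCTUATION-LEG PURE-GAUGE LAW OF `T₂ := wilsonW₂ d ((8N²)⁻¹ • wsym22 N)` ON `ℤ^{d+1}`**
(`2 ≤ N`; summation by parts on the finitely supported table, then (R3)'s `gaugeLeg_wilsonT2_inl_inl`), for EVERY `φ`: see the module docstring. -/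
theorem tsum_wilsonT2_mul_dz (hN : 2 ≤ N) (κ : Fin (d + 1)) (u : Site (d + 1)) (κ' : Fin (d + 1)) (u' x : Site (d + 1)) (α : Fin (d + 1))
    (φ : Site (d + 1) → ℝ) :
    ∑' z, ∑ β, wilsonW₂ d ((8 * (N : ℝ) ^ 2)⁻¹ • wsym22 N) κ u κ' u' x z (Sum.inl α) (Sum.inl β) * dz φ β z =
      -(1 / 2 : ℝ) * (φ (u' + unitVec κ') * wilsonA d κ u x u' (Sum.inl α) (Sum.inl κ') + φ (u + unitVec κ) * wilsonA d κ' u' x u (Sum.inl α) (Sum.inl κ))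
      - (1 / 4 : ℝ) * ((if u = u' ∧ κ = κ' then (1 : ℝ) else 0) * φ (u + unitVec κ) * curvAdj (curv (delta1 κ u)) α x)
      + (1 / 8 : ℝ) * φ (x + unitVec α)
          * ((if x = u' ∧ α = κ' then (1 : ℝ) else 0) * curvAdj (curv (delta1 κ u)) α x
            + (if x = u ∧ α = κ then (1 : ℝ) else 0) * curvAdj (curv (delta1 κ' u')) α x) := by
  classical
  set T₂ := wilsonW₂ d ((8 * (N : ℝ) ^ 2)⁻¹ • wsym22 N) with hT₂
  -- summability of every piece (finite support in the second leg)
  have hs1 : ∀ β, Summable fun z => φ (z + unitVec β) * T₂ κ u κ' u' x z (Sum.inl α) (Sum.inl β) :=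
    fun β => summable_mul_wilsonW₂ _ κ u κ' u' x α β (fun z => φ (z + unitVec β))
  have hs2 : ∀ β, Summable fun z => φ z * T₂ κ u κ' u' x z (Sum.inl α) (Sum.inl β) :=
    fun β => summable_mul_wilsonW₂ _ κ u κ' u' x α β φ
  have hs3 : ∀ β, Summable fun z => φ z * T₂ κ u κ' u' x (z - unitVec β) (Sum.inl α) (Sum.inl β) := by
    intro β
    have h := (Equiv.subRight (unitVec β)).summable_iff.2 (hs1 β)
    refine h.congr fun z => ?_
    simp only [Function.comp_apply, Equiv.subRight_apply, sub_add_cancel]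
  have hshift : ∀ β, ∑' z, φ (z + unitVec β) * T₂ κ u κ' u' x z (Sum.inl α) (Sum.inl β) =
      ∑' z, φ z * T₂ κ u κ' u' x (z - unitVec β) (Sum.inl α) (Sum.inl β) := by
    intro β
    rw [← (Equiv.subRight (unitVec β)).tsum_eq (fun z => φ (z + unitVec β) * T₂ κ u κ' u' x z (Sum.inl α) (Sum.inl β))]
    refine tsum_congr fun z => ?_
    simp only [Equiv.subRight_apply, sub_add_cancel]
  have hL : ∀ z, ∑ β, T₂ κ u κ' u' x z (Sum.inl α) (Sum.inl β) * dz φ β z =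
      ∑ β, (φ (z + unitVec β) * T₂ κ u κ' u' x z (Sum.inl α) (Sum.inl β) - φ z * T₂ κ u κ' u' x z (Sum.inl α) (Sum.inl β)) := by
    intro z
    refine Finset.sum_congr rfl fun β _ => ?_
    rw [dz_apply', ← affine_unitVec_eq]; ring
  -- by parts
  have hbp : ∑' z, ∑ β, T₂ κ u κ' u' x z (Sum.inl α) (Sum.inl β) * dz φ β z =
      ∑' z, φ z * ∑ β, (T₂ κ u κ' u' x (z - unitVec β) (Sum.inl α) (Sum.inl β) - T₂ κ u κ' u' x z (Sum.inl α) (Sum.inl β)) := by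
    have hR : ∀ z, φ z * ∑ β, (T₂ κ u κ' u' x (z - unitVec β) (Sum.inl α) (Sum.inl β) - T₂ κ u κ' u' x z (Sum.inl α) (Sum.inl β)) =
        ∑ β, (φ z * T₂ κ u κ' u' x (z - unitVec β) (Sum.inl α) (Sum.inl β) - φ z * T₂ κ u κ' u' x z (Sum.inl α) (Sum.inl β)) := by
      intro z
      rw [Finset.mul_sum]
      exact Finset.sum_congr rfl fun β _ => by ring
    rw [tsum_congr hL, tsum_congr hR, Summable.tsum_finsetSum (fun β _ => (hs1 β).sub (hs2 β)),
      Summable.tsum_finsetSum (fun β _ => (hs3 β).sub (hs2 β))]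
    refine Finset.sum_congr rfl fun β _ => ?_
    rw [(hs1 β).tsum_sub (hs2 β), (hs3 β).tsum_sub (hs2 β), hshift β]
  rw [hbp]
  -- the divergence form, then the three site deltas
  simp only [hT₂, gaugeLeg_wilsonT2_inl_inl hN]
  set S : Finset (Site (d + 1)) := {u' + unitVec κ', u + unitVec κ, x + unitVec α} with hS
  have hu' : u' + unitVec κ' ∈ S := by simp [hS]
  have hu : u + unitVec κ ∈ S := by simp [hS]
  have hx : x + unitVec α ∈ S := by simp [hS]
  rw [tsum_eq_sum (s := S) (fun z hz => by
    have h1 : u' + unitVec κ' ≠ z := fun h => hz (h ▸ hu')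
    have h2 : u + unitVec κ ≠ z := fun h => hz (h ▸ hu)
    have h3 : x + unitVec α ≠ z := fun h => hz (h ▸ hx)
    rw [if_neg h1, if_neg h2, if_neg h3]; ring)]
  have e : ∀ z ∈ S, φ z * (-(1 / 2 : ℝ) * ((if u' + unitVec κ' = z then (1 : ℝ) else 0) * wilsonA d κ u x u' (Sum.inl α) (Sum.inl κ')
          + (if u + unitVec κ = z then (1 : ℝ) else 0) * wilsonA d κ' u' x u (Sum.inl α) (Sum.inl κ))
        - (1 / 4 : ℝ) * ((if u = u' ∧ κ = κ' then (1 : ℝ) else 0) * (if u + unitVec κ = z then (1 : ℝ) else 0) * curvAdj (curv (delta1 κ u)) α x)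
        + (1 / 8 : ℝ) * (if x + unitVec α = z then (1 : ℝ) else 0)
          * ((if x = u' ∧ α = κ' then (1 : ℝ) else 0) * curvAdj (curv (delta1 κ u)) α x
            + (if x = u ∧ α = κ then (1 : ℝ) else 0) * curvAdj (curv (delta1 κ' u')) α x)) =
      -(1 / 2 : ℝ) * wilsonA d κ u x u' (Sum.inl α) (Sum.inl κ') * (φ z * (if u' + unitVec κ' = z then (1 : ℝ) else 0))
        + -(1 / 2 : ℝ) * wilsonA d κ' u' x u (Sum.inl α) (Sum.inl κ) * (φ z * (if u + unitVec κ = z then (1 : ℝ) else 0))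
        - (1 / 4 : ℝ) * ((if u = u' ∧ κ = κ' then (1 : ℝ) else 0) * curvAdj (curv (delta1 κ u)) α x) * (φ z * (if u + unitVec κ = z then (1 : ℝ) else 0))
        + (1 / 8 : ℝ) * ((if x = u' ∧ α = κ' then (1 : ℝ) else 0) * curvAdj (curv (delta1 κ u)) α x
            + (if x = u ∧ α = κ then (1 : ℝ) else 0) * curvAdj (curv (delta1 κ' u')) α x) * (φ z * (if x + unitVec α = z then (1 : ℝ) else 0)) := by
    intro z _; ring
  rw [Finset.sum_congr rfl e, Finset.sum_add_distrib, Finset.sum_sub_distrib, Finset.sum_add_distrib, ← Finset.mul_sum, ← Finset.mul_sum,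
    ← Finset.mul_sum, ← Finset.mul_sum, sum_mul_ite_eq_of_mem φ hu', sum_mul_ite_eq_of_mem φ hu, sum_mul_ite_eq_of_mem φ hx]
  ring

end ByParts

/-! ## §2 The torus: the second-slot-periodised bi-family, periodised, against the gradient of ANY `Mℤ^{d+1}`-periodic potential -/

section Torus

open AffineAveraging (unitVec)
open Summit.QuantumFields.BalabanUV.Beta.CombWilsonT2Periodised (dper_apply_of_periodCov wilsonT2per_periodCov wilsonT2per_ff_eq_zero_of_not_mem_S
  summable_wilsonT2_translate)
open Summit.QuantumFields.BalabanUV.Beta.FP.KernelPeriodisationFib (Idx perF perF_apply perZ perZ_apply)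
open Summit.QuantumFields.BalabanUV.Beta.FP.KernelPeriodisationFibLoc (dper)
open Summit.QuantumFields.BalabanUV.Beta.FP.PeriodisedBorderTables (dper_apply_of_blockCov)
open Summit.QuantumFields.BalabanUV.Beta.FP.PeriodisedBorderIndexWard (translate_injective)
open Summit.QuantumFields.BalabanUV.Beta.FP.PeriodisedFormGaugeLeg (sum_perZ_mul_grad_periodic_ff)
open Summit.QuantumFields.BalabanUV.Beta.BorderedHessian (bhK bhKAt bhKAt_inl_inl bhK_inl_inl_eq bhKStepAt bhKStepAt_zero)
open Summit.QuantumFields.BalabanUV.Beta.GAN24.ContactOneGaugeCellAlgebra (wilsonA_inl_inl_eq_zero_of_lt_idx wilsonA_inl_inl_eq_zero_of_lt_right)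
open Summit.QuantumFields.BalabanUV.Beta.GAN24.ContactOneGaugeCellMaxwell (curvAdj_curv_delta1_eq_zero_of_not_mem)
open B6Lemma24Torus (wrap wrap_eq_self wrap_congr)

variable (M : Fin (d + 1) → ℕ) [∀ μ, NeZero (M μ)]

omit [∀ μ, NeZero (M μ)] in
/-- [folklore] a torus point is the wrapped representative of each of its copies. -/
theorem wrap_translate_of_mem {u : Site (d + 1)} (hu : u ∈ pbox M) (m : Site (d + 1)) : wrap M (translate M u m) = u :=
  (wrap_congr (M := M) fun i => ⟨m i, by rw [translate_apply]; ring⟩).trans (wrap_eq_self hu)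

/-- [folklore] two copies of two torus points coincide iff the points AND the copies do. -/
theorem translate_eq_translate_iff {u u' : Site (d + 1)} (hu : u ∈ pbox M) (hu' : u' ∈ pbox M) (m n : Site (d + 1)) :
    translate M u m = translate M u' n ↔ u = u' ∧ m = n := by
  refine ⟨fun h => ?_, fun h => by rw [h.1, h.2]⟩
  have hw := congrArg (wrap M) h
  rw [wrap_translate_of_mem M hu, wrap_translate_of_mem M hu'] at hw
  subst hw
  exact ⟨rfl, translate_injective (M := M) u h⟩

omit [∀ μ, NeZero (M μ)] in
/-- [folklore] membership in a translated cube window from an `ℓ¹` bound. -/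
theorem mem_window_of_l1_le {k : ℕ} {x w : Site (d + 1)} (h : l1 (x - w) ≤ k) : w ∈ (cube (d + 1) k).image (fun v => x - v) :=
  Finset.mem_image.2 ⟨x - w, mem_cube_of_l1_le h, sub_sub_cancel x w⟩

omit [∀ μ, NeZero (M μ)] in
/-- [folklore] cube windows are monotone in the radius. -/
theorem mem_window_mono {j k : ℕ} (hjk : j ≤ k) {x w : Site (d + 1)} (h : w ∈ (cube (d + 1) j).image (fun v => x - v)) :
    w ∈ (cube (d + 1) k).image (fun v => x - v) := by
  obtain ⟨v, hv, rfl⟩ := Finset.mem_image.1 h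
  refine Finset.mem_image.2 ⟨v, mem_cube.2 fun i => ((mem_cube.1 hv) i).trans (by exact_mod_cast hjk), rfl⟩

/-- **[folklore] `sum_perZ_dper_wilsonT2per_mul_grad_periodic` — THE FLUCTUATION-LEG PURE-GAUGE LAW OF THE PERIODISED WILSON BI-FAMILY** (any box `M`, `2 ≤ N`,
both index bonds and the first leg at torus points, ANY `Mℤ^{d+1}`-periodic potential `φ`; `V κ u := Σ'_n T₂ κ u κ′ (u′ + M∘n)` of U21's `hW`):
`Σ_{(y,β)} perZ M (dper M (V κ u)) x y (inl α) (inl β)·(φ(y + e_β) − φ y)`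
`  = −½·(φ(u′+e_κ′)·perZ M (dper M (wilsonA d κ u)) x u′ (inl α) (inl κ′) + φ(u+e_κ)·perZ M (dper M (wilsonA d κ′ u′)) x u (inl α) (inl κ))`
`    − ¼·[u = u′ ∧ κ = κ′]·φ(u+e_κ)·perZ M (bhKStepAt d ρ L 0) x u (inl α) (inl κ)`
`    + ⅛·φ(x+e_α)·([x = u′ ∧ α = κ′]·perZ M (bhKStepAt d ρ L 0) x u (inl α) (inl κ) + [x = u ∧ α = κ]·perZ M (bhKStepAt d ρ L 0) x u′ (inl α) (inl κ′))`
— §1 per pair of copies of the two index bonds, re-summed: the first-order members periodise to leaf-05's `perZ M (dper M (wilsonA …))`, the `d*d` contacts to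
the periodised form block, the diagonal contact survives only between EQUAL torus bonds (`translate_eq_translate_iff`). -/
theorem sum_perZ_dper_wilsonT2per_mul_grad_periodic (hN : 2 ≤ N) (κ' : Fin (d + 1)) {u' : Site (d + 1)} (hu' : u' ∈ pbox M)
    {V : Fin (d + 1) → Site (d + 1) → MKer (d + 1) (Fib d)}
    (hV : V = fun κ u x z a c => ∑' n : Site (d + 1), wilsonW₂ d ((8 * (N : ℝ) ^ 2)⁻¹ • wsym22 N) κ u κ' (translate M u' n) x z a c)
    (ρ : Site (d + 1)) (L : ℕ) [NeZero L] (κ : Fin (d + 1)) {u : Site (d + 1)} (hu : u ∈ pbox M) {x : Site (d + 1)} (hx : x ∈ pbox M)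
    (α : Fin (d + 1)) {φ : Site (d + 1) → ℝ} (hφ : ∀ z m, φ (translate M z m) = φ z) :
    ∑ y : ↥(pbox M), ∑ β : Fin (d + 1), perZ M (dper M (V κ u)) x (y : Site (d + 1)) (Sum.inl α) (Sum.inl β)
        * (φ ((y : Site (d + 1)) + unitVec β) - φ y) =
      -(1 / 2 : ℝ) * (φ (u' + unitVec κ') * perZ M (dper M (wilsonA d κ u)) x u' (Sum.inl α) (Sum.inl κ')
          + φ (u + unitVec κ) * perZ M (dper M (wilsonA d κ' u')) x u (Sum.inl α) (Sum.inl κ))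
      - (1 / 4 : ℝ) * ((if u = u' ∧ κ = κ' then (1 : ℝ) else 0) * φ (u + unitVec κ) * perZ M (bhKStepAt d ρ L 0) x u (Sum.inl α) (Sum.inl κ))
      + (1 / 8 : ℝ) * φ (x + unitVec α)
          * ((if x = u' ∧ α = κ' then (1 : ℝ) else 0) * perZ M (bhKStepAt d ρ L 0) x u (Sum.inl α) (Sum.inl κ)
            + (if x = u ∧ α = κ then (1 : ℝ) else 0) * perZ M (bhKStepAt d ρ L 0) x u' (Sum.inl α) (Sum.inl κ')) := by
  classical
  set T₂ := wilsonW₂ d ((8 * (N : ℝ) ^ 2)⁻¹ • wsym22 N) with hT₂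
  -- the finite windows of copies of the two index bonds that can see the first leg `x`
  set W : Finset (Site (d + 1)) := (cube (d + 1) 4).image (fun v => x - v) with hW
  set Fm : Finset (Site (d + 1)) := W.preimage (fun m => translate M u m) (translate_injective (M := M) u).injOn with hFm
  set Fn : Finset (Site (d + 1)) := W.preimage (fun n => translate M u' n) (translate_injective (M := M) u').injOn with hFn
  have hFm' : ∀ m ∉ Fm, translate M u m ∉ W := fun m hm h => hm (Finset.mem_preimage.2 h)
  have hFn' : ∀ n ∉ Fn, translate M u' n ∉ W := fun n hn h => hn (Finset.mem_preimage.2 h)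
  -- support: every piece vanishes outside `Fm × Fn`
  have sT : ∀ (m n z : Site (d + 1)) (β : Fin (d + 1)), (m ∉ Fm ∨ n ∉ Fn) →
      T₂ κ (translate M u m) κ' (translate M u' n) x z (Sum.inl α) (Sum.inl β) = 0 := by
    intro m n z β hmn
    rw [hT₂, wilsonW₂_inl_inl]
    rcases wEntry₂_eq_zero_or ((8 * (N : ℝ) ^ 2)⁻¹ • wsym22 N) κ (translate M u m) κ' (translate M u' n) x z α β with h0 | ⟨hxu, -, huu⟩
    · exact h0
    · exfalso
      rcases hmn with hm | hn
      · exact hFm' m hm (mem_window_of_l1_le (hxu.trans (by norm_num)))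
      · exact hFn' n hn (mem_window_of_l1_le (((l1_sub_triangle x (translate M u m) (translate M u' n)).trans
          (add_le_add hxu ((l1_sub_symm _ _).le.trans huu))).trans (by norm_num)))
  have sA1 : ∀ m n : Site (d + 1), (m ∉ Fm ∨ n ∉ Fn) → wilsonA d κ (translate M u m) x (translate M u' n) (Sum.inl α) (Sum.inl κ') = 0 := by
    intro m n hmn
    by_cases h1 : 2 < l1 (x - translate M u m)
    · exact wilsonA_inl_inl_eq_zero_of_lt_idx κ _ x _ α κ' h1
    by_cases h2 : 2 < l1 (translate M u' n - translate M u m)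
    · exact wilsonA_inl_inl_eq_zero_of_lt_right κ _ x _ α κ' h2
    exfalso
    rw [not_lt] at h1 h2
    rcases hmn with hm | hn
    · exact hFm' m hm (mem_window_of_l1_le (h1.trans (by norm_num)))
    · exact hFn' n hn (mem_window_of_l1_le (((l1_sub_triangle x (translate M u m) (translate M u' n)).trans
        (add_le_add h1 ((l1_sub_symm _ _).le.trans h2))).trans (by norm_num)))
  have sA2 : ∀ m n : Site (d + 1), (m ∉ Fm ∨ n ∉ Fn) → wilsonA d κ' (translate M u' n) x (translate M u m) (Sum.inl α) (Sum.inl κ) = 0 := by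
    intro m n hmn
    by_cases h1 : 2 < l1 (x - translate M u' n)
    · exact wilsonA_inl_inl_eq_zero_of_lt_idx κ' _ x _ α κ h1
    by_cases h2 : 2 < l1 (translate M u m - translate M u' n)
    · exact wilsonA_inl_inl_eq_zero_of_lt_right κ' _ x _ α κ h2
    exfalso
    rw [not_lt] at h1 h2
    rcases hmn with hm | hn
    · exact hFm' m hm (mem_window_of_l1_le (((l1_sub_triangle x (translate M u' n) (translate M u m)).trans
        (add_le_add h1 ((l1_sub_symm _ _).le.trans h2))).trans (by norm_num)))
    · exact hFn' n hn (mem_window_of_l1_le (h1.trans (by norm_num)))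
  have sD : ∀ m ∉ Fm, curvAdj (curv (delta1 κ (translate M u m))) α x = 0 := fun m hm =>
    curvAdj_curv_delta1_eq_zero_of_not_mem fun h => hFm' m hm (mem_window_mono (by norm_num) (Finset.mem_image.2 ⟨_, h, sub_sub_cancel _ _⟩))
  have sD' : ∀ n ∉ Fn, curvAdj (curv (delta1 κ' (translate M u' n))) α x = 0 := fun n hn =>
    curvAdj_curv_delta1_eq_zero_of_not_mem fun h => hFn' n hn (mem_window_mono (by norm_num) (Finset.mem_image.2 ⟨_, h, sub_sub_cancel _ _⟩))
  -- bookkeeping: unit steps and the origin copy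
  have htr : ∀ (v : Site (d + 1)) (γ : Fin (d + 1)) (m : Site (d + 1)), translate M v m + unitVec γ = translate M (v + unitVec γ) m :=
    fun v γ m => by funext i; simp only [translate_apply, Pi.add_apply]; ring
  have htr0 : ∀ v : Site (d + 1), translate M v 0 = v := fun v => by funext i; simp only [translate_apply, Pi.zero_apply, mul_zero, add_zero]
  have hxW : x ∈ W := mem_window_of_l1_le (by rw [sub_self]; simp [l1])
  have hFm0 : x = u → (0 : Site (d + 1)) ∈ Fm := fun h => Finset.mem_preimage.2 (show translate M u 0 ∈ W by rw [htr0, ← h]; exact hxW)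
  have hFn0 : x = u' → (0 : Site (d + 1)) ∈ Fn := fun h => Finset.mem_preimage.2 (show translate M u' 0 ∈ W by rw [htr0, ← h]; exact hxW)
  -- Step A: torus pairing = lattice pairing against `dz φ`
  have hVp := wilsonT2per_periodCov (M := M) (κ' := κ') (u' := u') ((8 * (N : ℝ) ^ 2)⁻¹ • wsym22 N) hV
  have hdper : ∀ (z : Site (d + 1)) (β : Fin (d + 1)), dper M (V κ u) x z (Sum.inl α) (Sum.inl β) =
      ∑ m ∈ Fm, ∑ n ∈ Fn, T₂ κ (translate M u m) κ' (translate M u' n) x z (Sum.inl α) (Sum.inl β) := by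
    intro z β
    rw [dper_apply_of_periodCov V hVp κ u x z]
    rw [tsum_eq_sum (s := Fm) (fun m hm => by
      rw [hV]
      exact (tsum_congr fun n => sT m n z β (Or.inl hm)).trans tsum_zero)]
    refine Finset.sum_congr rfl fun m _ => ?_
    rw [hV]
    exact tsum_eq_sum (s := Fn) fun n hn => sT m n z β (Or.inr hn)
  have hK : ∀ (β : Fin (d + 1)) (g : Site (d + 1) → ℝ), Summable fun z => dper M (V κ u) x z (Sum.inl α) (Sum.inl β) * g z := by
    intro β g
    refine summable_of_ne_finset_zero (s := (cube (d + 1) 6).image (fun v => x - v)) fun z hz => ?_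
    rw [dper_apply_of_periodCov V hVp κ u x z, (tsum_congr fun m => ?_).trans tsum_zero, zero_mul]
    exact wilsonT2per_ff_eq_zero_of_not_mem_S _ hV κ _ x α β z hz
  rw [sum_perZ_mul_grad_periodic_ff M (dper M (V κ u)) x α hφ hK]
  -- Step B: the finite double sum of copies out of the lattice sum
  have hsw : ∑' z : Site (d + 1), ∑ β : Fin (d + 1), dper M (V κ u) x z (Sum.inl α) (Sum.inl β) * dz φ β z =
      ∑ m ∈ Fm, ∑ n ∈ Fn, ∑' z : Site (d + 1), ∑ β : Fin (d + 1), T₂ κ (translate M u m) κ' (translate M u' n) x z (Sum.inl α) (Sum.inl β) * dz φ β z := by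
    have hsmn : ∀ m n, Summable fun z => ∑ β : Fin (d + 1), T₂ κ (translate M u m) κ' (translate M u' n) x z (Sum.inl α) (Sum.inl β) * dz φ β z :=
      fun m n => summable_sum fun β _ => ((summable_mul_wilsonW₂ _ κ _ κ' _ x α β (fun z => dz φ β z)).congr fun z => mul_comm _ _)
    have hin : ∀ m, ∑ n ∈ Fn, ∑' z : Site (d + 1), ∑ β : Fin (d + 1), T₂ κ (translate M u m) κ' (translate M u' n) x z (Sum.inl α) (Sum.inl β) * dz φ β z =
        ∑' z : Site (d + 1), ∑ n ∈ Fn, ∑ β : Fin (d + 1), T₂ κ (translate M u m) κ' (translate M u' n) x z (Sum.inl α) (Sum.inl β) * dz φ β z :=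
      fun m => (Summable.tsum_finsetSum (fun n _ => hsmn m n)).symm
    rw [Finset.sum_congr rfl (fun m _ => hin m), ← Summable.tsum_finsetSum (fun m _ => summable_sum fun n _ => hsmn m n)]
    refine tsum_congr fun z => ?_
    simp only [hdper, Finset.sum_mul]
    rw [Finset.sum_comm]
    exact Finset.sum_congr rfl fun m _ => Finset.sum_comm
  -- Step C: §1 per pair of copies, the potential read back on the torus
  have hcopy : ∀ m n : Site (d + 1),
      ∑' z : Site (d + 1), ∑ β : Fin (d + 1), T₂ κ (translate M u m) κ' (translate M u' n) x z (Sum.inl α) (Sum.inl β) * dz φ β z =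
        (-(1 / 2 : ℝ) * φ (u' + unitVec κ')) * wilsonA d κ (translate M u m) x (translate M u' n) (Sum.inl α) (Sum.inl κ')
        + (-(1 / 2 : ℝ) * φ (u + unitVec κ)) * wilsonA d κ' (translate M u' n) x (translate M u m) (Sum.inl α) (Sum.inl κ)
        + (-(1 / 4 : ℝ) * φ (u + unitVec κ)) * ((if translate M u m = translate M u' n ∧ κ = κ' then (1 : ℝ) else 0)
            * curvAdj (curv (delta1 κ (translate M u m))) α x)
        + ((1 / 8 : ℝ) * φ (x + unitVec α)) * ((if x = translate M u' n ∧ α = κ' then (1 : ℝ) else 0)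
            * curvAdj (curv (delta1 κ (translate M u m))) α x)
        + ((1 / 8 : ℝ) * φ (x + unitVec α)) * ((if x = translate M u m ∧ α = κ then (1 : ℝ) else 0)
            * curvAdj (curv (delta1 κ' (translate M u' n))) α x) := by
    intro m n
    rw [hT₂, tsum_wilsonT2_mul_dz hN]
    simp only [b6UnitVec_eq]
    rw [htr u' κ' n, hφ, htr u κ m, hφ]
    ring
  -- Step D: the five re-summed pieces (in the shape `simp only [Finset.sum_add_distrib, ← Finset.mul_sum]` leaves them)
  have hM1 : ∀ i, M i = 1 * M i := fun i => (one_mul (M i)).symm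
  have hVt : ∀ (γ : Fin (d + 1)) (v t : Site (d + 1)), wilsonA d γ (v + ((1 : ℕ) : ℤ) • t) = shiftK (-(((1 : ℕ) : ℤ) • t)) (wilsonA d γ v) :=
    fun γ v t => wilsonA_translate γ v _
  have hP : ∀ (γ : Fin (d + 1)) (v : Site (d + 1)) (G : Finset (Site (d + 1))),
      (∀ m ∉ G, curvAdj (curv (delta1 γ (translate M v m))) α x = 0) →
      perZ M (bhKStepAt d ρ L 0) x v (Sum.inl α) (Sum.inl γ) = ∑ m ∈ G, curvAdj (curv (delta1 γ (translate M v m))) α x := by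
    intro γ v G hG
    rw [perZ_apply, tsum_eq_sum (s := G) fun m hm => by rw [bhKStepAt_zero, bhKAt_inl_inl, bhK_inl_inl_eq]; exact hG m hm]
    exact Finset.sum_congr rfl fun m _ => by rw [bhKStepAt_zero, bhKAt_inl_inl, bhK_inl_inl_eq]
  have hI : ∀ {v : Site (d + 1)}, v ∈ pbox M → ∀ (γ : Fin (d + 1)) (G : Finset (Site (d + 1))), (x = v → (0 : Site (d + 1)) ∈ G) → ∀ c : ℝ,
      ∑ n ∈ G, (if x = translate M v n ∧ α = γ then (1 : ℝ) else 0) * c = (if x = v ∧ α = γ then (1 : ℝ) else 0) * c := by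
    intro v hv γ G hG0 c
    have hxv : ∀ n, x = translate M v n ↔ x = v ∧ 0 = n := fun n => by
      have h := translate_eq_translate_iff M hx hv 0 n
      rwa [htr0] at h
    by_cases hc : x = v ∧ α = γ
    · rw [if_pos hc, Finset.sum_eq_single_of_mem (0 : Site (d + 1)) (hG0 hc.1) fun n _ hn => by
        rw [if_neg fun h => hn ((hxv n).1 h.1).2.symm, zero_mul]]
      rw [if_pos ⟨(hxv 0).2 ⟨hc.1, rfl⟩, hc.2⟩]
    · rw [if_neg hc, zero_mul]
      exact Finset.sum_eq_zero fun n _ => by rw [if_neg fun h => hc ⟨((hxv n).1 h.1).1, h.2⟩, zero_mul]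
  have E1 : ∑ m ∈ Fm, ∑ n ∈ Fn, wilsonA d κ (translate M u m) x (translate M u' n) (Sum.inl α) (Sum.inl κ') =
      perZ M (dper M (wilsonA d κ u)) x u' (Sum.inl α) (Sum.inl κ') := by
    have hn0 : ∀ n ∉ Fn, dper M (wilsonA d κ u) x (translate M u' n) (Sum.inl α) (Sum.inl κ') = 0 := fun n hn => by
      rw [dper_apply_of_blockCov hM1 hVt κ u x (translate M u' n)]
      exact (tsum_congr fun m => sA1 m n (Or.inr hn)).trans tsum_zero
    rw [perZ_apply, tsum_eq_sum (s := Fn) hn0, Finset.sum_comm]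
    refine Finset.sum_congr rfl fun n _ => ?_
    rw [dper_apply_of_blockCov hM1 hVt κ u x (translate M u' n)]
    exact (tsum_eq_sum (s := Fm) fun m hm => sA1 m n (Or.inl hm)).symm
  have E2 : ∑ m ∈ Fm, ∑ n ∈ Fn, wilsonA d κ' (translate M u' n) x (translate M u m) (Sum.inl α) (Sum.inl κ) =
      perZ M (dper M (wilsonA d κ' u')) x u (Sum.inl α) (Sum.inl κ) := by
    have hm0 : ∀ m ∉ Fm, dper M (wilsonA d κ' u') x (translate M u m) (Sum.inl α) (Sum.inl κ) = 0 := fun m hm => by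
      rw [dper_apply_of_blockCov hM1 hVt κ' u' x (translate M u m)]
      exact (tsum_congr fun n => sA2 m n (Or.inl hm)).trans tsum_zero
    rw [perZ_apply, tsum_eq_sum (s := Fm) hm0]
    refine Finset.sum_congr rfl fun m _ => ?_
    rw [dper_apply_of_blockCov hM1 hVt κ' u' x (translate M u m)]
    exact (tsum_eq_sum (s := Fn) fun n hn => sA2 m n (Or.inr hn)).symm
  have E3 : ∑ m ∈ Fm, ∑ n ∈ Fn, (if translate M u m = translate M u' n ∧ κ = κ' then (1 : ℝ) else 0) * curvAdj (curv (delta1 κ (translate M u m))) α x =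
      (if u = u' ∧ κ = κ' then (1 : ℝ) else 0) * perZ M (bhKStepAt d ρ L 0) x u (Sum.inl α) (Sum.inl κ) := by
    by_cases hc : u = u' ∧ κ = κ'
    · rw [if_pos hc, one_mul, hP κ u Fm sD]
      refine Finset.sum_congr rfl fun m hm => ?_
      have hmW : translate M u m ∈ W := Finset.mem_preimage.1 hm
      rw [Finset.sum_eq_single_of_mem m (Finset.mem_preimage.2 (show translate M u' m ∈ W from hc.1 ▸ hmW)) fun n _ hn => by
        rw [if_neg fun h => hn ((translate_eq_translate_iff M hu hu' m n).1 h.1).2.symm, zero_mul]]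
      rw [if_pos ⟨by rw [hc.1], hc.2⟩, one_mul]
    · rw [if_neg hc, zero_mul]
      exact Finset.sum_eq_zero fun m _ => Finset.sum_eq_zero fun n _ => by
        rw [if_neg fun h => hc ⟨((translate_eq_translate_iff M hu hu' m n).1 h.1).1, h.2⟩, zero_mul]
  have E4 : ∑ m ∈ Fm, ∑ n ∈ Fn, (if x = translate M u' n ∧ α = κ' then (1 : ℝ) else 0) * curvAdj (curv (delta1 κ (translate M u m))) α x =
      (if x = u' ∧ α = κ' then (1 : ℝ) else 0) * perZ M (bhKStepAt d ρ L 0) x u (Sum.inl α) (Sum.inl κ) := by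
    rw [hP κ u Fm sD, Finset.mul_sum]
    exact Finset.sum_congr rfl fun m _ => hI hu' κ' Fn hFn0 _
  have E5 : ∑ m ∈ Fm, (if x = translate M u m ∧ α = κ then (1 : ℝ) else 0) * ∑ n ∈ Fn, curvAdj (curv (delta1 κ' (translate M u' n))) α x =
      (if x = u ∧ α = κ then (1 : ℝ) else 0) * perZ M (bhKStepAt d ρ L 0) x u' (Sum.inl α) (Sum.inl κ') := by
    rw [← hP κ' u' Fn sD']
    exact hI hu κ Fm hFm0 _
  -- Step E: assemble
  rw [hsw, Finset.sum_congr rfl fun m _ => Finset.sum_congr rfl fun n _ => hcopy m n]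
  simp only [Finset.sum_add_distrib, ← Finset.mul_sum]
  rw [E1, E2, E3, E4, E5]
  ring

end Torus

end Summit.QuantumFields.BalabanUV.Beta.FP.PeriodisedFormGaugeLegTwo

end
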